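import Literature.AlgebraicGeometry.Motives.HodgeNumberUpperSemicontinuous
import Literature.Geometry.Manifold.ProperSubmersionLocalTrivialisation
import Literature.Geometry.Manifold.SmoothEmbeddingInverse
import Literature.Geometry.Kaehler.KaehlerPullback
import Literature.Geometry.Kaehler.TransportDefectContinuity
import Literature.Topology.FourManifolds.ImmersionCriterion
import Literature.NumberTheory.Transcendental.FormIntegrationVolumeFormProofs
import Literature.NumberTheory.Transcendental.FormIntegrationPullbackCharts
import Literature.NumberTheory.Transcendental.FormIntegrationPositivity
import Mathlib.Geometry.Manifold.VectorBundle.LocalFrame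
import HarnessLib

/-!
# Upper semicontinuity of the Hodge numbers of the fibres of a proper holomorphic submersion
# into a Kähler manifold

Topic: Hodge numbers in families (Voisin (2002), §9.3). Let `T` be a complex manifold with a
Kähler metric `G_T`, `π : T → B` a `C^∞` map to a real manifold which is a submersion over an open
`O ∋ s₀` and proper over `O`, and let `s_i → s₀` in `B`. Suppose the fibres are parametrised by
compact complex manifolds: `ψ₀ : M₀ → T` and `ψ_i : M_i → T` are injective holomorphic immersions
(`C^∞`, injective, with injective `ℂ`-linear differentials) with images `π⁻¹(s₀)` and `π⁻¹(s_i)`,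
all of the same dimension. **Then `dim K^{p,q}(M_i) ≥ N` for all `i` implies
`dim K^{p,q}(M₀) ≥ N`** (`le_finrank_hodgePQ_of_fibres`), where `K^{p,q} = hodgePQ` is the space of
de Rham classes of closed `(p,q)`-forms; for compact Kähler manifolds `dim K^{p,q} = h^{p,q}`.
This is the upper semicontinuity `h^{p,q}(X_s) ≤ h^{p,q}(X_{s₀})` of Voisin (2002), §9.3.2,
Prop. 9.20 / Thm. 9.23 (there via elliptic theory, Thm. 9.15; Kodaira–Spencer), in the Kähler
case, proved here by the soft route of `Motives/HodgeNumberUpperSemicontinuous`: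

1. the fibres carry the induced Kähler metrics `g = ψ^* G_T` (`KaehlerPullback`);
2. Ehresmann's theorem in its smooth local form (`ProperSubmersionLocalTrivialisation`) gives
   diffeomorphisms `Tr(u, ·)` of a tube `W ⊇ π⁻¹(s₀)`, jointly `C^∞` in `(u, y)`, `Tr(0, ·) = id`,
   carrying `π⁻¹(s₀)` onto `π⁻¹(s)` for `u = τ(s)`, `τ` continuous with `τ(s₀) = 0`; composed with
   the embeddings (`SmoothEmbeddingInverse`, `ImmersionCriterion`) they give diffeomorphisms
   `Φ_i : M₀ → M_i` with `ψ_i ∘ Φ_i = Tr(τ(s_i), ψ₀ ·)`;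
3. by joint continuity of `(u, x) ↦ D_x Tr(u, ψ₀ x)` as a map to the tangent bundle of `T`
   (`TransportDefectContinuity`) and compactness of `M₀`, the Gram defect
   `|g_i(DΦ_i v, DΦ_i w) - g₀(v, w)|` and the holomorphy defect `‖J_i DΦ_i v - DΦ_i J₀ v‖` are
   `≤ ε ‖v‖ ‖w‖`, resp. `≤ ε ‖v‖`, for `i` large;
4. along a subsequence these defects are `≤ 1/(m+1)`, and `le_finrank_hodgePQ_of_transport` applies
   (orientations: a constant orientation of the model of `M₀`, transported to `M_i` by `DΦ_i`).

## References

* C. Voisin, *Hodge Theory and Complex Algebraic Geometry I*, CUP 2002, §9.1.1 (Thm. 9.3,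
  Prop. 9.5), §9.3.2 (Prop. 9.20, Thm. 9.23); held text
  `book:voisin2002-hodge-theory-complex-algebraic-geometry-i`, PDF pp. 183–186, 194–198.
  [cite: VoisinHodgeI2002, §9.3.2 Prop. 9.20]
* K. Kodaira, *Complex Manifolds and Deformation of Complex Structures*, Springer 1986, §7.2.
-/

noncomputable section

open scoped Manifold ContDiff Topology InnerProductSpace
open Bundle Module Set Filter Function
open Literature.Geometry.Kaehler Literature.Geometry.Manifold Literature.NumberTheory.Transcendental

namespace Literature.AlgebraicGeometry.Motives

-- The identification `TangentSpace I x = E` is an abuse of definitional equality; as in Mathlib's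
-- tangent-bundle files we let `isDefEq` unfold it.
set_option backward.isDefEq.respectTransparency false

universe u v

/-! ### Auxiliary results -/

section Aux

/-- A bilinear form evaluated on two linear combinations. [folklore] -/
theorem clm_sum_smul_sum_smul {V : Type*} [AddCommGroup V] [Module ℝ V] [TopologicalSpace V]
    (B : V →L[ℝ] V →L[ℝ] ℝ) {ι : Type*} [Fintype ι] (c d : ι → ℝ) (x y : ι → V) :
    B (∑ j, c j • x j) (∑ l, d l • y l) = ∑ j, ∑ l, c j * d l * B (x j) (y l) := by
  have h1 : B (∑ j, c j • x j) = ∑ j, c j • B (x j) := by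
    rw [map_sum]
    exact Finset.sum_congr rfl fun j _ ↦ by rw [map_smul]
  rw [h1, FunLike.coe_sum, Finset.sum_apply]
  refine Finset.sum_congr rfl fun j _ ↦ ?_
  rw [FunLike.coe_smul, Pi.smul_apply, map_sum, smul_eq_mul, Finset.mul_sum]
  refine Finset.sum_congr rfl fun l _ ↦ ?_
  rw [map_smul, smul_eq_mul]
  ring

/-- **A smooth metric evaluated on two `C⁰` maps into the tangent bundle over the same base map is
continuous** (the `clm_bundle_apply₂` argument of Mathlib's `ContMDiffWithinAt.inner_bundle`,
stated for an explicit `ContMDiffRiemannianMetric` so that no normed instances on the tangent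
spaces are involved). [folklore] -/
theorem continuousAt_inner_of_contMDiffAt
    {EM : Type*} [NormedAddCommGroup EM] [NormedSpace ℝ EM] {HM : Type*} [TopologicalSpace HM]
    {IM : ModelWithCorners ℝ EM HM} {M : Type*} [TopologicalSpace M] [ChartedSpace HM M]
    [IsManifold IM ∞ M]
    {EP : Type*} [NormedAddCommGroup EP] [NormedSpace ℝ EP] {HP : Type*} [TopologicalSpace HP]
    {IP : ModelWithCorners ℝ EP HP} {P : Type*} [TopologicalSpace P] [ChartedSpace HP P]
    (G : ContMDiffRiemannianMetric IM ∞ EM (fun y : M ↦ TangentSpace IM y))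
    {b : P → M} {v w : ∀ z : P, TangentSpace IM (b z)} {z₀ : P}
    (hv : ContMDiffAt IP IM.tangent 0 (fun z ↦ (⟨b z, v z⟩ : TangentBundle IM M)) z₀)
    (hw : ContMDiffAt IP IM.tangent 0 (fun z ↦ (⟨b z, w z⟩ : TangentBundle IM M)) z₀) :
    ContinuousAt (fun z ↦ G.inner (b z) (v z) (w z)) z₀ := by
  have hb : ContMDiffAt IP IM 0 b z₀ := (contMDiffAt_totalSpace.1 hv).1
  have hψ : ContMDiffAt IP (IM.prod 𝓘(ℝ, EM →L[ℝ] EM →L[ℝ] ℝ)) 0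
      (fun z ↦ TotalSpace.mk' (EM →L[ℝ] EM →L[ℝ] ℝ)
        (E := fun y : M ↦ TangentSpace IM y →L[ℝ] TangentSpace IM y →L[ℝ] ℝ) (b z)
          (G.inner (b z))) z₀ :=
    (G.contMDiff.of_le (by simp)).contMDiffAt.comp z₀ hb
  have h : ContMDiffAt IP (IM.prod 𝓘(ℝ, ℝ)) 0
      (fun z ↦ TotalSpace.mk' ℝ (E := Bundle.Trivial M ℝ) (b z) (G.inner (b z) (v z) (w z))) z₀ := by
    apply ContMDiffAt.clm_bundle_apply₂ (F₁ := EM) (F₂ := EM)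
    · exact hψ
    · exact hv
    · exact hw
  rw [contMDiffAt_totalSpace] at h
  exact h.2.continuousAt

/-- Transport of a metric evaluation along an equality of base points (the tangent spaces at all
points are the model space by definition). [folklore] -/
theorem metric_inner_congr_point
    {EM : Type*} [NormedAddCommGroup EM] [NormedSpace ℝ EM] {HM : Type*} [TopologicalSpace HM]
    {IM : ModelWithCorners ℝ EM HM} {M : Type*} [TopologicalSpace M] [ChartedSpace HM M]
    [IsManifold IM ∞ M]
    (G : ContMDiffRiemannianMetric IM ∞ EM (fun y : M ↦ TangentSpace IM y)) {y y' : M}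
    (h : y = y') (a b : TangentSpace IM y) : G.inner y a b = G.inner y' a b := by
  subst h
  rfl

variable {E₀ : Type*} [NormedAddCommGroup E₀] [NormedSpace ℝ E₀] [FiniteDimensional ℝ E₀]
  {M₀ : Type*} [TopologicalSpace M₀] [ChartedSpace E₀ M₀]

/-- On a Riemannian bundle of rank `n` (model `E₀` with `dim E₀ = n`) there is an orientation of
the model space which is represented, at every point, by an orthonormal frame of the fibre (for
`n = 0` the positive orientation, otherwise any orientation: adjust an orthonormal basis).
[folklore] -/
theorem exists_orientation_forall_orthonormalBasis (n : ℕ) [Fact (finrank ℝ E₀ = n)]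
    [RiemannianBundle (fun x : M₀ ↦ TangentSpace 𝓘(ℝ, E₀) x)] :
    ∃ oE : Orientation ℝ E₀ (Fin n), ∀ x : M₀,
      ∃ b : OrthonormalBasis (Fin n) ℝ (TangentSpace 𝓘(ℝ, E₀) x), b.toBasis.orientation = oE := by
  have hE : finrank ℝ E₀ = n := Fact.out
  rcases Nat.eq_zero_or_pos n with hn | hn
  · subst hn
    refine ⟨positiveOrientation, fun x ↦ ?_⟩
    refine ⟨(stdOrthonormalBasis ℝ (TangentSpace 𝓘(ℝ, E₀) x)).reindex (finCongr hE), ?_⟩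
    exact Module.Basis.orientation_isEmpty _
  · haveI : Nonempty (Fin n) := ⟨⟨0, hn⟩⟩
    refine ⟨(Module.finBasisOfFinrankEq ℝ E₀ hE).orientation, fun x ↦ ?_⟩
    exact ⟨((stdOrthonormalBasis ℝ (TangentSpace 𝓘(ℝ, E₀) x)).reindex (finCongr hE)).adjustToOrientation
      ((Module.finBasisOfFinrankEq ℝ E₀ hE).orientation),
      OrthonormalBasis.orientation_adjustToOrientation _ _⟩

variable [IsManifold 𝓘(ℝ, E₀) ∞ M₀] [CompactSpace M₀]
  {E₁ : Type*} [NormedAddCommGroup E₁] [NormedSpace ℝ E₁] [FiniteDimensional ℝ E₁]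
  {M₁ : Type*} [TopologicalSpace M₁] [ChartedSpace E₁ M₁] [IsManifold 𝓘(ℝ, E₁) ∞ M₁]
  [CompactSpace M₁]
  {ET : Type*} [NormedAddCommGroup ET] [NormedSpace ℝ ET] [FiniteDimensional ℝ ET]
  {T : Type*} [TopologicalSpace T] [ChartedSpace ET T] [IsManifold 𝓘(ℝ, ET) ∞ T] [T2Space T]

/-- **Transport of embedded compact submanifolds by a diffeomorphism of a tube gives a
diffeomorphism of the parametrising manifolds.** Let `ψ₀ : M₀ → T`, `ψ₁ : M₁ → T` be injective
immersions of compact manifolds (hence embeddings), `W ⊇ range ψ₀ ∪ range ψ₁` open, and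
`Θ, Θ' : T → T` mutually inverse `C^∞` self-maps of `W` (`W ⊇` both ranges) with `Θ(y) ∈ range ψ₁ ↔ y ∈ range ψ₀`
on `W`. Then `Φ = ψ₁⁻¹ ∘ Θ ∘ ψ₀` is a diffeomorphism `M₀ ≅ M₁` with `ψ₁ ∘ Φ = Θ ∘ ψ₀` (Lee
(2013), Prop. 5.2 ff.: smooth maps into an embedded submanifold; `contMDiffOn_invFun_range`).
[cite: LeeSmoothManifolds2013, Prop. 4.22] -/
theorem exists_diffeomorph_of_transport [Nonempty M₀] [Nonempty M₁]
    {ψ₀ : M₀ → T} (h₀ : ContMDiff 𝓘(ℝ, E₀) 𝓘(ℝ, ET) ∞ ψ₀) (h₀i : Injective ψ₀)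
    (h₀d : ∀ x, Injective (mfderiv 𝓘(ℝ, E₀) 𝓘(ℝ, ET) ψ₀ x))
    {ψ₁ : M₁ → T} (h₁ : ContMDiff 𝓘(ℝ, E₁) 𝓘(ℝ, ET) ∞ ψ₁) (h₁i : Injective ψ₁)
    (h₁d : ∀ x, Injective (mfderiv 𝓘(ℝ, E₁) 𝓘(ℝ, ET) ψ₁ x))
    {W : Set T} {Θ Θ' : T → T} (hΘ : ContMDiffOn 𝓘(ℝ, ET) 𝓘(ℝ, ET) ∞ Θ W)
    (hΘ' : ContMDiffOn 𝓘(ℝ, ET) 𝓘(ℝ, ET) ∞ Θ' W) (hΘ'W : MapsTo Θ' W W)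
    (hΘ'Θ : ∀ y ∈ W, Θ' (Θ y) = y) (hΘΘ' : ∀ y ∈ W, Θ (Θ' y) = y)
    (hr₀ : range ψ₀ ⊆ W) (hr₁ : range ψ₁ ⊆ W)
    (hfib : ∀ y ∈ W, (Θ y ∈ range ψ₁ ↔ y ∈ range ψ₀)) :
    ∃ Φ : Diffeomorph 𝓘(ℝ, E₀) 𝓘(ℝ, E₁) M₀ M₁ ∞, ∀ x, ψ₁ (Φ x) = Θ (ψ₀ x) := by
  have he₀ := Literature.Topology.FourManifolds.isSmoothEmbedding_of_injective_of_injective_mfderiv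
    (I := 𝓘(ℝ, E₀)) (J := 𝓘(ℝ, ET)) h₀ (by simp) h₀i h₀d
  have he₁ := Literature.Topology.FourManifolds.isSmoothEmbedding_of_injective_of_injective_mfderiv
    (I := 𝓘(ℝ, E₁)) (J := 𝓘(ℝ, ET)) h₁ (by simp) h₁i h₁d
  have hinv₀ := contMDiffOn_invFun_range he₀
  have hinv₁ := contMDiffOn_invFun_range he₁
  -- `Θ ∘ ψ₀` lands in `range ψ₁`, `Θ' ∘ ψ₁` lands in `range ψ₀`
  have hin₁ : ∀ x, Θ (ψ₀ x) ∈ range ψ₁ := fun x ↦ (hfib _ (hr₀ ⟨x, rfl⟩)).2 ⟨x, rfl⟩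
  have hin₀ : ∀ y, Θ' (ψ₁ y) ∈ range ψ₀ := by
    intro y
    have hy : Θ' (ψ₁ y) ∈ W := hΘ'W (hr₁ ⟨y, rfl⟩)
    exact (hfib _ hy).1 (by rw [hΘΘ' _ (hr₁ ⟨y, rfl⟩)]; exact ⟨y, rfl⟩)
  refine ⟨{ toFun := fun x ↦ Function.invFun ψ₁ (Θ (ψ₀ x)),
             invFun := fun y ↦ Function.invFun ψ₀ (Θ' (ψ₁ y)),
             left_inv := fun x ↦ ?_,
             right_inv := fun y ↦ ?_,
             contMDiff_toFun := ?_,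
             contMDiff_invFun := ?_ }, fun x ↦ ?_⟩
  · simp only
    rw [Function.invFun_eq (hin₁ x), hΘ'Θ _ (hr₀ ⟨x, rfl⟩)]
    exact Function.leftInverse_invFun h₀i x
  · simp only
    rw [Function.invFun_eq (hin₀ y), hΘΘ' _ (hr₁ ⟨y, rfl⟩)]
    exact Function.leftInverse_invFun h₁i y
  · exact hinv₁.comp_contMDiff (hΘ.comp_contMDiff h₀ fun x ↦ hr₀ ⟨x, rfl⟩) hin₁
  · exact hinv₀.comp_contMDiff (hΘ'.comp_contMDiff h₁ fun y ↦ hr₁ ⟨y, rfl⟩) hin₀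
  · exact Function.invFun_eq (hin₁ x)

omit [FiniteDimensional ℝ E₀] [CompactSpace M₀] [FiniteDimensional ℝ E₁] [CompactSpace M₁]
  [IsManifold 𝓘(ℝ, E₀) ∞ M₀] [IsManifold 𝓘(ℝ, E₁) ∞ M₁] in
/-- **Transport of an orientation family by a diffeomorphism.** Given `Φ : M₀ ≅ M₁` and a pointwise
orientation `o₀` of `M₀`, the family `o₁ (Φ x) := DΦ_x (o₀ x)` on `M₁` is compatible with `Φ`
(by definition) and with `Φ⁻¹` (its differential `D(Φ⁻¹)_y = (DΦ_{Φ⁻¹ y})⁻¹` carries `o₁ y` back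
to `o₀ (Φ⁻¹ y)`), in the form required by `isContinuousOrientation_of_orientationMap`.
[folklore] -/
theorem exists_orientation_transport {n : ℕ} (Φ : Diffeomorph 𝓘(ℝ, E₀) 𝓘(ℝ, E₁) M₀ M₁ ∞)
    (o₀ : (x : M₀) → Orientation ℝ (TangentSpace 𝓘(ℝ, E₀) x) (Fin n)) :
    ∃ o₁ : (y : M₁) → Orientation ℝ (TangentSpace 𝓘(ℝ, E₁) y) (Fin n),
      (∀ x, Orientation.map (Fin n)
        (Φ.mfderivToContinuousLinearEquiv (by simp) x).toLinearEquiv (o₀ x) = o₁ (Φ x)) ∧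
      ∀ y, ∃ L : TangentSpace 𝓘(ℝ, E₁) y ≃ₗ[ℝ] TangentSpace 𝓘(ℝ, E₀) (Φ.symm y),
        (∀ v, L v = mfderiv 𝓘(ℝ, E₁) 𝓘(ℝ, E₀) Φ.symm y v) ∧
          Orientation.map (Fin n) L (o₁ y) = o₀ (Φ.symm y) := by
  -- the transported orientation, as a function to the (constant) type of orientations of `E₁`
  let G : M₀ → Orientation ℝ E₁ (Fin n) := fun z ↦
    Orientation.map (Fin n) (Φ.mfderivToContinuousLinearEquiv (by simp) z).toLinearEquiv (o₀ z)
  let o₀' : M₀ → Orientation ℝ E₀ (Fin n) := fun z ↦ o₀ z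
  refine ⟨fun y ↦ G (Φ.symm y), fun x ↦ ?_, fun y ↦ ?_⟩
  · exact congrArg G (Φ.symm_apply_apply x).symm
  · obtain ⟨x, rfl⟩ : ∃ x, Φ x = y := ⟨Φ.symm y, Φ.apply_symm_apply y⟩
    refine ⟨(Φ.mfderivToContinuousLinearEquiv (by simp) x).symm.toLinearEquiv, fun v ↦
      Literature.Geometry.Kaehler.mfderivToContinuousLinearEquiv_symm_apply Φ x v, ?_⟩
    have h1 : G (Φ.symm (Φ x)) = G x := congrArg G (Φ.symm_apply_apply x)
    have h2 : o₀' (Φ.symm (Φ x)) = o₀' x := congrArg o₀' (Φ.symm_apply_apply x)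
    change Orientation.map (Fin n) _ (G (Φ.symm (Φ x))) = o₀' (Φ.symm (Φ x))
    rw [h1, h2]
    change Orientation.map (Fin n) (Φ.mfderivToContinuousLinearEquiv (by simp) x).toLinearEquiv.symm
      (Orientation.map (Fin n) (Φ.mfderivToContinuousLinearEquiv (by simp) x).toLinearEquiv (o₀ x)) =
      o₀ x
    rw [← Orientation.map_symm, Equiv.symm_apply_apply]

end Aux

/-! ### The theorem -/

variable {ET : Type*} [NormedAddCommGroup ET] [NormedSpace ℂ ET] [FiniteDimensional ℂ ET]
  {T : Type*} [TopologicalSpace T] [ChartedSpace ET T] [IsManifold 𝓘(ℝ, ET) ∞ T]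
  [IsManifold 𝓘(ℂ, ET) ω T] [T2Space T] [SecondCountableTopology T]
  (GT : ContMDiffRiemannianMetric 𝓘(ℝ, ET) ∞ ET (fun y : T ↦ TangentSpace 𝓘(ℝ, ET) y))
  {EB : Type*} [NormedAddCommGroup EB] [NormedSpace ℝ EB] [FiniteDimensional ℝ EB]
  {B : Type*} [TopologicalSpace B] [ChartedSpace EB B] [IsManifold 𝓘(ℝ, EB) ∞ B]
  {E₀ : Type*} [NormedAddCommGroup E₀] [NormedSpace ℂ E₀] [FiniteDimensional ℂ E₀]
  {M₀ : Type*} [TopologicalSpace M₀] [ChartedSpace E₀ M₀] [IsManifold 𝓘(ℝ, E₀) ∞ M₀]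
  [IsManifold 𝓘(ℂ, E₀) ω M₀] [T2Space M₀] [CompactSpace M₀] {n : ℕ} [Fact (finrank ℝ E₀ = n)]

set_option maxHeartbeats 1600000 in
/-- **Upper semicontinuity of `dim K^{p,q}` for the fibres of a proper submersion into a Kähler
manifold, parametrised by injective holomorphic immersions** (Voisin (2002), §9.3.2 Prop. 9.20 /
Thm. 9.23 in the Kähler case; see the module docstring for the statement and the proof).
[cite: VoisinHodgeI2002, §9.3.2 Prop. 9.20] -/
theorem le_finrank_hodgePQ_of_fibres (hGT : GT.toRiemannianMetric.IsKaehler)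
    {proj : T → B} (hπ : ContMDiff 𝓘(ℝ, ET) 𝓘(ℝ, EB) ∞ proj) {s₀ : B} {O : Set B} (hO : IsOpen O)
    (hs₀ : s₀ ∈ O) (hsub : ∀ x, proj x ∈ O → Surjective (mfderiv 𝓘(ℝ, ET) 𝓘(ℝ, EB) proj x))
    (hprop : ∀ K ⊆ O, IsCompact K → IsCompact (proj ⁻¹' K))
    {s : ℕ → B} (hs : Tendsto s atTop (𝓝 s₀))
    {ψ₀ : M₀ → T} (hψ₀ : ContMDiff 𝓘(ℝ, E₀) 𝓘(ℝ, ET) ∞ ψ₀) (hψ₀i : Injective ψ₀)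
    (hψ₀d : ∀ x, Injective (mfderiv 𝓘(ℝ, E₀) 𝓘(ℝ, ET) ψ₀ x))
    (hψ₀J : ∀ (x : M₀) (v : TangentSpace 𝓘(ℝ, E₀) x),
      mfderiv 𝓘(ℝ, E₀) 𝓘(ℝ, ET) ψ₀ x (tangentJ E₀ x v) =
        tangentJ ET (ψ₀ x) (mfderiv 𝓘(ℝ, E₀) 𝓘(ℝ, ET) ψ₀ x v))
    (hψ₀r : range ψ₀ = proj ⁻¹' {s₀})
    (Em : ℕ → Type u) [∀ i, NormedAddCommGroup (Em i)] [∀ i, NormedSpace ℂ (Em i)]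
    [∀ i, FiniteDimensional ℂ (Em i)] [∀ i, Fact (finrank ℝ (Em i) = n)]
    (Mf : ℕ → Type v) [∀ i, TopologicalSpace (Mf i)] [∀ i, ChartedSpace (Em i) (Mf i)]
    [∀ i, IsManifold 𝓘(ℝ, Em i) ∞ (Mf i)] [∀ i, IsManifold 𝓘(ℂ, Em i) ω (Mf i)]
    [∀ i, T2Space (Mf i)] [∀ i, CompactSpace (Mf i)]
    (ψ : ∀ i, Mf i → T) (hψ : ∀ i, ContMDiff 𝓘(ℝ, Em i) 𝓘(ℝ, ET) ∞ (ψ i))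
    (hψi : ∀ i, Injective (ψ i))
    (hψd : ∀ i y, Injective (mfderiv 𝓘(ℝ, Em i) 𝓘(ℝ, ET) (ψ i) y))
    (hψJ : ∀ i (y : Mf i) (v : TangentSpace 𝓘(ℝ, Em i) y),
      mfderiv 𝓘(ℝ, Em i) 𝓘(ℝ, ET) (ψ i) y (tangentJ (Em i) y v) =
        tangentJ ET (ψ i y) (mfderiv 𝓘(ℝ, Em i) 𝓘(ℝ, ET) (ψ i) y v))
    (hψr : ∀ i, range (ψ i) = proj ⁻¹' {s i})
    {k p q N : ℕ} (hk : k ≤ n) (hN : ∀ i, N ≤ finrank ℂ ↥(hodgePQ (Em i) (Mf i) k p q)) :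
    N ≤ finrank ℂ ↥(hodgePQ E₀ M₀ k p q) := by
  classical
  -- Borel structures on the model spaces (any choice)
  letI : MeasurableSpace E₀ := borel E₀
  haveI : BorelSpace E₀ := ⟨rfl⟩
  letI mEm : ∀ i, MeasurableSpace (Em i) := fun i ↦ borel (Em i)
  haveI : ∀ i, BorelSpace (Em i) := fun i ↦ ⟨rfl⟩
  have hE₀ : finrank ℝ E₀ = n := Fact.out
  set d := finrank ℝ EB with hd
  /- ### Step 1: the smooth local trivialisation of `proj` near `proj⁻¹(s₀)` -/
  obtain ⟨W, τ, Tr, Sr, hWo, hW₀, hτc, hτ0, hTr, hSr, hTrW, hSrW, hST, hTS, hT0, hfib⟩ :=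
    exists_localTrivialisation_of_surjective_mfderiv hπ hO hs₀ hsub hprop
  have hψ₀W : ∀ x, ψ₀ x ∈ W := fun x ↦ hW₀ (by rw [← hψ₀r]; exact ⟨x, rfl⟩)
  -- the sequence of parameters
  set u : ℕ → EuclideanSpace ℝ (Fin d) := fun i ↦ τ (s i) with hu
  have hu0 : Tendsto u atTop (𝓝 0) := by
    have := (hτc.tendsto.comp hs)
    rwa [hτ0] at this
  have hfibi : ∀ᶠ i in atTop, proj ⁻¹' {s i} ⊆ W ∧ ∀ y ∈ W, (proj (Tr (u i, y)) = s i ↔ proj y = s₀) :=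
    hs.eventually hfib
  /- ### Step 2: the empty case -/
  rcases isEmpty_or_nonempty M₀ with hM₀ | hM₀
  · -- all later fibres are empty, so `N = 0`
    obtain ⟨i, hiW, hi⟩ := hfibi.exists
    have hempty : IsEmpty (Mf i) := by
      refine ⟨fun y ↦ ?_⟩
      have hy : ψ i y ∈ W := hiW (by rw [← hψr]; exact ⟨y, rfl⟩)
      have hy' : Sr (u i, ψ i y) ∈ W := hSrW _ _ hy
      have h1 : proj (Tr (u i, Sr (u i, ψ i y))) = s i := by
        rw [hTS _ _ hy]
        have : ψ i y ∈ proj ⁻¹' {s i} := by rw [← hψr]; exact ⟨y, rfl⟩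
        exact this
      have h2 : proj (Sr (u i, ψ i y)) = s₀ := (hi _ hy').1 h1
      have h3 : Sr (u i, ψ i y) ∈ range ψ₀ := by rw [hψ₀r]; exact h2
      obtain ⟨x, -⟩ := h3
      exact hM₀.false x
    have h0 : finrank ℂ ↥(hodgePQ (Em i) (Mf i) k p q) = 0 := by
      haveI : Subsingleton (cclosedSmoothForms (Em i) (Mf i) k) :=
        ⟨fun a b ↦ Subtype.ext (funext fun y ↦ (hempty.false y).elim)⟩
      haveI : Subsingleton (complexDeRhamCohomology (Em i) (Mf i) k) :=
        Quotient.instSubsingletonQuotient _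
      haveI : Subsingleton ↥(hodgePQ (Em i) (Mf i) k p q) :=
        ⟨fun a b ↦ Subtype.ext (Subsingleton.elim _ _)⟩
      exact finrank_zero_of_subsingleton
    have := hN i
    omega
  /- ### Step 3: the joint family `F (u, x) = Tr (u, ψ₀ x)` -/
  set F : EuclideanSpace ℝ (Fin d) × M₀ → T := fun z ↦ Tr (z.1, ψ₀ z.2) with hF
  have hFs : ContMDiff (𝓘(ℝ, EuclideanSpace ℝ (Fin d)).prod 𝓘(ℝ, E₀)) 𝓘(ℝ, ET) ∞ F :=
    hTr.comp_contMDiff (contMDiff_fst.prodMk (hψ₀.comp contMDiff_snd))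
      fun z ↦ ⟨mem_univ _, hψ₀W z.2⟩
  have hF0 : ∀ x, F (0, x) = ψ₀ x := fun x ↦ hT0 _ (hψ₀W x)
  have hF0' : (fun x ↦ F (0, x)) = ψ₀ := funext hF0
  have hFu : ∀ w : EuclideanSpace ℝ (Fin d), ContMDiff 𝓘(ℝ, E₀) 𝓘(ℝ, ET) ∞ fun x ↦ F (w, x) :=
    fun w ↦ hFs.comp (contMDiff_const.prodMk contMDiff_id)
  /- ### Step 4: the induced Kähler metrics -/
  obtain ⟨g₀, hg₀K, hg₀i⟩ := exists_isKaehler_inner_eq_pullback GT hGT hψ₀ hψ₀J hψ₀d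
  choose gM hgMK hgMi using fun i ↦ exists_isKaehler_inner_eq_pullback GT hGT (hψ i) (hψJ i) (hψd i)
  letI i₀ : RiemannianBundle (fun x : M₀ ↦ TangentSpace 𝓘(ℝ, E₀) x) := ⟨g₀.toRiemannianMetric⟩
  letI iM : ∀ i, RiemannianBundle (fun y : Mf i ↦ TangentSpace 𝓘(ℝ, Em i) y) :=
    fun i ↦ ⟨(gM i).toRiemannianMetric⟩
  letI iT : RiemannianBundle (fun y : T ↦ TangentSpace 𝓘(ℝ, ET) y) := ⟨GT.toRiemannianMetric⟩
  haveI : IsContMDiffRiemannianBundle 𝓘(ℝ, E₀) ∞ E₀ (fun x : M₀ ↦ TangentSpace 𝓘(ℝ, E₀) x) :=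
    ⟨g₀.inner, g₀.contMDiff, fun _ _ _ ↦ rfl⟩
  haveI : IsContinuousRiemannianBundle E₀ (fun x : M₀ ↦ TangentSpace 𝓘(ℝ, E₀) x) :=
    ⟨g₀.inner, g₀.contMDiff.continuous, fun _ _ _ ↦ rfl⟩
  haveI : ∀ i, IsContMDiffRiemannianBundle 𝓘(ℝ, Em i) ∞ (Em i)
      (fun y : Mf i ↦ TangentSpace 𝓘(ℝ, Em i) y) :=
    fun i ↦ ⟨(gM i).inner, (gM i).contMDiff, fun _ _ _ ↦ rfl⟩
  haveI : ∀ i, IsContinuousRiemannianBundle (Em i) (fun y : Mf i ↦ TangentSpace 𝓘(ℝ, Em i) y) :=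
    fun i ↦ ⟨(gM i).inner, (gM i).contMDiff.continuous, fun _ _ _ ↦ rfl⟩
  haveI : IsContMDiffRiemannianBundle 𝓘(ℝ, ET) ∞ ET (fun y : T ↦ TangentSpace 𝓘(ℝ, ET) y) :=
    ⟨GT.inner, GT.contMDiff, fun _ _ _ ↦ rfl⟩
  have hinner₀ : ∀ (x : M₀) (v w : TangentSpace 𝓘(ℝ, E₀) x),
      ⟪v, w⟫_ℝ = GT.inner (ψ₀ x) (mfderiv 𝓘(ℝ, E₀) 𝓘(ℝ, ET) ψ₀ x v)
        (mfderiv 𝓘(ℝ, E₀) 𝓘(ℝ, ET) ψ₀ x w) := fun x v w ↦ hg₀i x v w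
  have hinnerT : ∀ (y : T) (a b : TangentSpace 𝓘(ℝ, ET) y), ⟪a, b⟫_ℝ = GT.inner y a b :=
    fun _ _ _ ↦ rfl
  /- ### Step 5: orientation and frames on `M₀` -/
  obtain ⟨oE, hoE⟩ := exists_orientation_forall_orthonormalBasis (E₀ := E₀) (M₀ := M₀) n
  choose b hb using hoE
  set o₀ : (x : M₀) → Orientation ℝ (TangentSpace 𝓘(ℝ, E₀) x) (Fin n) := fun _ ↦ oE with ho₀def
  have ho₀c : IsContinuousOrientation (I := 𝓘(ℝ, E₀)) o₀ := isContinuousOrientation_const oE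
  have ho₀ : IsSmoothForm (riemannianVolumeForm o₀) :=
    isSmoothForm_riemannianVolumeForm_of_isContinuousOrientation_holds o₀ ho₀c
  /- ### Step 6: the defect estimates, uniformly on `M₀`, for small parameters -/
  -- the quantities
  have KEY : ∀ ε : ℝ, 0 < ε → ∀ᶠ w in 𝓝 (0 : EuclideanSpace ℝ (Fin d)), ∀ (x : M₀)
      (v v' : TangentSpace 𝓘(ℝ, E₀) x),
      |GT.inner (F (w, x)) (mfderiv 𝓘(ℝ, E₀) 𝓘(ℝ, ET) (fun x ↦ F (w, x)) x v)
          (mfderiv 𝓘(ℝ, E₀) 𝓘(ℝ, ET) (fun x ↦ F (w, x)) x v') - ⟪v, v'⟫_ℝ| ≤ ε * ‖v‖ * ‖v'‖ ∧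
      GT.inner (F (w, x))
          (tangentJ ET (F (w, x)) (mfderiv 𝓘(ℝ, E₀) 𝓘(ℝ, ET) (fun x ↦ F (w, x)) x v) -
            mfderiv 𝓘(ℝ, E₀) 𝓘(ℝ, ET) (fun x ↦ F (w, x)) x (tangentJ E₀ x v))
          (tangentJ ET (F (w, x)) (mfderiv 𝓘(ℝ, E₀) 𝓘(ℝ, ET) (fun x ↦ F (w, x)) x v) -
            mfderiv 𝓘(ℝ, E₀) 𝓘(ℝ, ET) (fun x ↦ F (w, x)) x (tangentJ E₀ x v)) ≤
        (ε * ‖v‖) ^ 2 := by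
    intro ε hε
    -- notation: the partial derivative of `F` in the `M₀`-direction
    set Dw : ∀ (w : EuclideanSpace ℝ (Fin d)) (x : M₀),
        TangentSpace 𝓘(ℝ, E₀) x →L[ℝ] TangentSpace 𝓘(ℝ, ET) (F (w, x)) :=
      fun w x ↦ mfderiv 𝓘(ℝ, E₀) 𝓘(ℝ, ET) (fun x ↦ F (w, x)) x with hDw
    -- smoothness of `z ↦ (F z, D F (X z.2)) ∈ TT` for a vector field `X` smooth at `z.2`
    have hV : ∀ {X : (x : M₀) → TangentSpace 𝓘(ℝ, E₀) x} {z : EuclideanSpace ℝ (Fin d) × M₀},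
        ContMDiffAt 𝓘(ℝ, E₀) 𝓘(ℝ, E₀).tangent 0
          (fun x ↦ (⟨x, X x⟩ : TangentBundle 𝓘(ℝ, E₀) M₀)) z.2 →
        ContMDiffAt (𝓘(ℝ, EuclideanSpace ℝ (Fin d)).prod 𝓘(ℝ, E₀)) 𝓘(ℝ, ET).tangent 0
          (fun z : EuclideanSpace ℝ (Fin d) × M₀ ↦
            (⟨F z, Dw z.1 z.2 (X z.2)⟩ : TangentBundle 𝓘(ℝ, ET) T)) z := by
      intro X z hX
      have hf : ContMDiffAt ((𝓘(ℝ, EuclideanSpace ℝ (Fin d)).prod 𝓘(ℝ, E₀)).prod 𝓘(ℝ, E₀))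
          𝓘(ℝ, ET) ∞ (uncurry fun (z : EuclideanSpace ℝ (Fin d) × M₀) (y : M₀) ↦ F (z.1, y))
          (z, z.2) :=
        (hFs.comp ((contMDiff_fst.comp contMDiff_fst).prodMk contMDiff_snd)).contMDiffAt
      exact contMDiffAt_mfderiv_apply_section (IP := (𝓘(ℝ, EuclideanSpace ℝ (Fin d))).prod 𝓘(ℝ, E₀))
        (fun (z : EuclideanSpace ℝ (Fin d) × M₀) (y : M₀) ↦ F (z.1, y)) (fun z ↦ z.2) X hf
        contMDiffAt_snd hX (by simp)
    -- the local statement near a point `x₀`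
    have hloc : ∀ x₀ : M₀, ∃ K ∈ 𝓝 x₀, ∀ᶠ w in 𝓝 (0 : EuclideanSpace ℝ (Fin d)), ∀ x ∈ K,
        ∀ (v v' : TangentSpace 𝓘(ℝ, E₀) x),
        |GT.inner (F (w, x)) (Dw w x v) (Dw w x v') - ⟪v, v'⟫_ℝ| ≤ ε * ‖v‖ * ‖v'‖ ∧
        GT.inner (F (w, x))
            (tangentJ ET (F (w, x)) (Dw w x v) - Dw w x (tangentJ E₀ x v))
            (tangentJ ET (F (w, x)) (Dw w x v) - Dw w x (tangentJ E₀ x v)) ≤ (ε * ‖v‖) ^ 2 := by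
      intro x₀
      set e := trivializationAt E₀ (TangentSpace 𝓘(ℝ, E₀)) x₀ with he
      set bE := Module.finBasisOfFinrankEq ℝ E₀ hE₀ with hbE
      set X : Fin n → (x : M₀) → TangentSpace 𝓘(ℝ, E₀) x := fun j ↦ e.localFrame bE j with hX
      have hfr := e.isLocalFrameOn_localFrame_baseSet 𝓘(ℝ, E₀) ∞ bE
      have hXs : ∀ j, ∀ x ∈ e.baseSet, ContMDiffAt 𝓘(ℝ, E₀) 𝓘(ℝ, E₀).tangent 0
          (fun x ↦ (⟨x, X j x⟩ : TangentBundle 𝓘(ℝ, E₀) M₀)) x :=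
        fun j x hx ↦ (contMDiffAt_localFrame_of_mem (n := ∞) e bE j hx).of_le (by simp)
      have hXJs : ∀ j, ∀ x ∈ e.baseSet, ContMDiffAt 𝓘(ℝ, E₀) 𝓘(ℝ, E₀).tangent 0
          (fun x ↦ (⟨x, tangentJ E₀ x (X j x)⟩ : TangentBundle 𝓘(ℝ, E₀) M₀)) x :=
        fun j x hx ↦ (hXs j x hx).tangentJ_bundle
      -- a compact neighbourhood of `x₀` inside the frame domain
      obtain ⟨K, hKc, hx₀K, hKU⟩ := exists_compact_subset e.open_baseSet
        (FiberBundle.mem_baseSet_trivializationAt' x₀)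
      haveI : CompactSpace K := isCompact_iff_compactSpace.1 hKc
      refine ⟨K, mem_interior_iff_mem_nhds.1 hx₀K, ?_⟩
      -- the Gram family of the frame and the two defect families
      set Γ : K → Fin n → Fin n → ℝ := fun x j l ↦ ⟪X j x, X l x⟫_ℝ with hΓ
      set A : ∀ (w : EuclideanSpace ℝ (Fin d)) (x : M₀) (j : Fin n),
          TangentSpace 𝓘(ℝ, ET) (F (w, x)) :=
        fun w x j ↦ tangentJ ET (F (w, x)) (Dw w x (X j x)) - Dw w x (tangentJ E₀ x (X j x))
        with hA
      set Θ₁ : EuclideanSpace ℝ (Fin d) → K → Fin n → Fin n → ℝ := fun w x j l ↦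
        GT.inner (F (w, x)) (Dw w x (X j x)) (Dw w x (X l x)) - Γ x j l with hΘ₁
      set Θ₂ : EuclideanSpace ℝ (Fin d) → K → Fin n → Fin n → ℝ := fun w x j l ↦
        GT.inner (F (w, x)) (A w x j) (A w x l) with hΘ₂
      -- continuity
      have hcont : ∀ j l, Continuous fun qq : EuclideanSpace ℝ (Fin d) × K ↦ Θ₁ qq.1 qq.2 j l := by
        intro j l
        refine continuous_iff_continuousAt.2 fun qq ↦ ?_
        have hx : (qq.2 : M₀) ∈ e.baseSet := hKU qq.2.2
        have hι : Continuous fun qq : EuclideanSpace ℝ (Fin d) × K ↦ ((qq.1, (qq.2 : M₀)) :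
            EuclideanSpace ℝ (Fin d) × M₀) :=
          continuous_fst.prodMk (continuous_subtype_val.comp continuous_snd)
        have h1 : ContinuousAt (fun z : EuclideanSpace ℝ (Fin d) × M₀ ↦
            GT.inner (F z) (Dw z.1 z.2 (X j z.2)) (Dw z.1 z.2 (X l z.2))) (qq.1, (qq.2 : M₀)) :=
          continuousAt_inner_of_contMDiffAt GT (hV (hXs j _ hx)) (hV (hXs l _ hx))
        have h2 : ContinuousAt (fun z : EuclideanSpace ℝ (Fin d) × M₀ ↦
            g₀.inner z.2 (X j z.2) (X l z.2)) (qq.1, (qq.2 : M₀)) := by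
          have := continuousAt_inner_of_contMDiffAt (IP := 𝓘(ℝ, E₀)) g₀ (hXs j _ hx) (hXs l _ hx)
          exact ContinuousAt.comp (f := (Prod.snd : EuclideanSpace ℝ (Fin d) × M₀ → M₀))
            (x := (qq.1, (qq.2 : M₀))) this continuousAt_snd
        exact ContinuousAt.comp (f := fun qq : EuclideanSpace ℝ (Fin d) × K ↦
          ((qq.1, (qq.2 : M₀)) : EuclideanSpace ℝ (Fin d) × M₀)) (h1.sub h2) hι.continuousAt
      have hcont₂ : ∀ j l, Continuous fun qq : EuclideanSpace ℝ (Fin d) × K ↦ Θ₂ qq.1 qq.2 j l := by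
        intro j l
        refine continuous_iff_continuousAt.2 fun qq ↦ ?_
        have hx : (qq.2 : M₀) ∈ e.baseSet := hKU qq.2.2
        have hι : Continuous fun qq : EuclideanSpace ℝ (Fin d) × K ↦ ((qq.1, (qq.2 : M₀)) :
            EuclideanSpace ℝ (Fin d) × M₀) :=
          continuous_fst.prodMk (continuous_subtype_val.comp continuous_snd)
        -- `z ↦ (F z, A z j) ∈ TT` is continuous: difference of `J ∘ V_j` and `V'_j`
        have hAj : ∀ j, ContMDiffAt (𝓘(ℝ, EuclideanSpace ℝ (Fin d)).prod 𝓘(ℝ, E₀)) 𝓘(ℝ, ET).tangent 0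
            (fun z : EuclideanSpace ℝ (Fin d) × M₀ ↦ (⟨F z, A z.1 z.2 j⟩ : TangentBundle 𝓘(ℝ, ET) T))
            (qq.1, (qq.2 : M₀)) := by
          intro j
          have hJV := (hV (hXs j _ hx) (z := (qq.1, (qq.2 : M₀)))).tangentJ_bundle
          have hV' := hV (hXJs j _ hx) (z := (qq.1, (qq.2 : M₀)))
          rw [contMDiffAt_totalSpace] at hJV hV' ⊢
          refine ⟨hV'.1, ?_⟩
          have := hJV.2.sub hV'.2
          refine this.congr_of_eventuallyEq (Eventually.of_forall fun z ↦ ?_)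
          simp only [trivializationAt_tangentSpace_snd, hA]
          exact (tangentCoordChange 𝓘(ℝ, ET) _ _ _).map_sub _ _
        have h1 : ContinuousAt (fun z : EuclideanSpace ℝ (Fin d) × M₀ ↦
            GT.inner (F z) (A z.1 z.2 j) (A z.1 z.2 l)) (qq.1, (qq.2 : M₀)) :=
          continuousAt_inner_of_contMDiffAt GT (hAj j) (hAj l)
        exact ContinuousAt.comp (f := fun qq : EuclideanSpace ℝ (Fin d) × K ↦
          ((qq.1, (qq.2 : M₀)) : EuclideanSpace ℝ (Fin d) × M₀)) h1 hι.continuousAt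
      -- vanishing at `w = 0`
      have hDw0 : ∀ x : M₀, Dw 0 x = mfderiv 𝓘(ℝ, E₀) 𝓘(ℝ, ET) ψ₀ x := by
        intro x
        simp only [hDw]
        rw [hF0']
      have hΘ₁0 : ∀ (x : K) j l, Θ₁ 0 x j l = 0 := by
        intro x j l
        simp only [hΘ₁, hΓ]
        rw [hinner₀, metric_inner_congr_point GT (hF0 x), hDw0]
        exact sub_eq_zero.2 rfl
      have hDw0v : ∀ (x : M₀) (vv : TangentSpace 𝓘(ℝ, E₀) x),
          Dw 0 x vv = mfderiv 𝓘(ℝ, E₀) 𝓘(ℝ, ET) ψ₀ x vv := fun x vv ↦ by rw [hDw0]; rfl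
      have hA0 : ∀ (x : M₀) j, A 0 x j = 0 := by
        intro x j
        simp only [hA]
        rw [hDw0v, hDw0v, hψ₀J]
        exact sub_eq_zero.2 rfl
      have hΘ₂0 : ∀ (x : K) j l, Θ₂ 0 x j l = 0 := by
        intro x j l
        simp only [hΘ₂]
        rw [hA0, hA0, map_zero]
      -- the Gram family: continuity and positivity
      have hΓc : ∀ j l, Continuous fun x : K ↦ Γ x j l := by
        intro j l
        refine continuous_iff_continuousAt.2 fun x ↦ ?_
        have := continuousAt_inner_of_contMDiffAt (IP := 𝓘(ℝ, E₀)) g₀ (hXs j _ (hKU x.2))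
          (hXs l _ (hKU x.2))
        exact ContinuousAt.comp (f := (Subtype.val : K → M₀)) this continuous_subtype_val.continuousAt
      have hsumΓ : ∀ (x : M₀) (c c' : Fin n → ℝ), ∑ j, ∑ l, c j * c' l * ⟪X j x, X l x⟫_ℝ =
          ⟪∑ j, c j • X j x, ∑ l, c' l • X l x⟫_ℝ := by
        intro x c c'
        rw [← innerSL_apply_apply ℝ (∑ j, c j • X j x) (∑ l, c' l • X l x), clm_sum_smul_sum_smul]
        rfl
      have hΓpos : ∀ (x : K) (c : Fin n → ℝ), c ≠ 0 → 0 < ∑ j, ∑ l, c j * c l * Γ x j l := by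
        intro x c hc
        have hli : LinearIndependent ℝ (fun j ↦ X j (x : M₀)) := hfr.linearIndependent (hKU x.2)
        have hv : (∑ j, c j • X j (x : M₀)) ≠ 0 := by
          intro h0
          exact hc (funext fun j ↦ (Fintype.linearIndependent_iff.1 hli) c h0 j)
        simp only [hΓ]
        rw [hsumΓ]
        exact real_inner_self_pos.2 hv
      -- the abstract uniformity lemma, twice
      have hU₁ := eventually_abs_sum_mul_mul_le_mul_sqrt (p₀ := (0 : EuclideanSpace ℝ (Fin d)))
        Θ₁ Γ hcont hΘ₁0 hΓc hΓpos hε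
      have hU₂ := eventually_abs_sum_mul_mul_le_mul_sqrt (p₀ := (0 : EuclideanSpace ℝ (Fin d)))
        Θ₂ Γ hcont₂ hΘ₂0 hΓc hΓpos (pow_pos hε 2)
      filter_upwards [hU₁, hU₂] with w h₁ h₂ x hx v v'
      -- expand `v, v'` in the frame at `x`
      have hxU : x ∈ e.baseSet := hKU hx
      set xK : K := ⟨x, hx⟩ with hxK
      set β := hfr.toBasisAt hxU with hβ
      have hβX : ∀ j, β j = X j x := fun j ↦ hfr.toBasisAt_coe hxU j
      set c : Fin n → ℝ := fun j ↦ β.repr v j with hc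
      set c' : Fin n → ℝ := fun j ↦ β.repr v' j with hc'
      have hv : v = ∑ j, c j • X j x := by
        conv_lhs => rw [← β.sum_repr v]
        exact Finset.sum_congr rfl fun j _ ↦ by rw [hβX]
      have hv' : v' = ∑ j, c' j • X j x := by
        conv_lhs => rw [← β.sum_repr v']
        exact Finset.sum_congr rfl fun j _ ↦ by rw [hβX]
      have hnorm : ∀ (vv : TangentSpace 𝓘(ℝ, E₀) x) (cc : Fin n → ℝ), vv = ∑ j, cc j • X j x →
          Real.sqrt (∑ j, ∑ l, cc j * cc l * Γ xK j l) = ‖vv‖ := by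
        intro vv cc hvv
        simp only [hΓ]
        rw [hsumΓ, ← hvv, real_inner_self_eq_norm_sq, Real.sqrt_sq (norm_nonneg _)]
      have hnv := hnorm v c hv
      have hnv' := hnorm v' c' hv'
      -- linearity of `Dw w x` and of `A w x` in the frame
      have hDv : ∀ (vv : TangentSpace 𝓘(ℝ, E₀) x) (cc : Fin n → ℝ), vv = ∑ j, cc j • X j x →
          Dw w x vv = ∑ j, cc j • Dw w x (X j x) := by
        intro vv cc hvv
        rw [hvv, map_sum]
        exact Finset.sum_congr rfl fun j _ ↦ by rw [map_smul]
      refine ⟨?_, ?_⟩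
      · have hexp : GT.inner (F (w, x)) (Dw w x v) (Dw w x v') - ⟪v, v'⟫_ℝ =
            ∑ j, ∑ l, c j * c' l * Θ₁ w xK j l := by
          simp only [hΘ₁, hΓ, mul_sub, Finset.sum_sub_distrib]
          rw [hsumΓ, ← hv, ← hv', hDv v c hv, hDv v' c' hv', clm_sum_smul_sum_smul]
        rw [hexp]
        refine (h₁ xK c c').trans (le_of_eq ?_)
        rw [hnv, hnv']
      · have hAv : tangentJ ET (F (w, x)) (Dw w x v) - Dw w x (tangentJ E₀ x v) =
            ∑ j, c j • A w x j := by
          have hJv : tangentJ E₀ x v = ∑ j, c j • tangentJ E₀ x (X j x) := by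
            rw [hv, map_sum]
            exact Finset.sum_congr rfl fun j _ ↦ by rw [map_smul]
          rw [hDv v c hv, hJv, map_sum, map_sum, ← Finset.sum_sub_distrib]
          refine Finset.sum_congr rfl fun j _ ↦ ?_
          rw [map_smul, map_smul, hA, smul_sub]
        rw [hAv, clm_sum_smul_sum_smul]
        calc ∑ j, ∑ l, c j * c l * GT.inner (F (w, x)) (A w x j) (A w x l)
            ≤ |∑ j, ∑ l, c j * c l * Θ₂ w xK j l| := le_abs_self _
          _ ≤ ε ^ 2 * Real.sqrt (∑ j, ∑ l, c j * c l * Γ xK j l) *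
                Real.sqrt (∑ j, ∑ l, c j * c l * Γ xK j l) := h₂ xK c c
          _ = (ε * ‖v‖) ^ 2 := by rw [hnv]; ring
    -- compactness of `M₀`
    choose Kx hKx hKw using hloc
    obtain ⟨t, -, ht⟩ := isCompact_univ.elim_nhds_subcover Kx fun x _ ↦ hKx x
    have hall : ∀ᶠ w in 𝓝 (0 : EuclideanSpace ℝ (Fin d)), ∀ x₁ ∈ t, ∀ x ∈ Kx x₁,
        ∀ (v v' : TangentSpace 𝓘(ℝ, E₀) x),
        |GT.inner (F (w, x)) (Dw w x v) (Dw w x v') - ⟪v, v'⟫_ℝ| ≤ ε * ‖v‖ * ‖v'‖ ∧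
        GT.inner (F (w, x))
            (tangentJ ET (F (w, x)) (Dw w x v) - Dw w x (tangentJ E₀ x v))
            (tangentJ ET (F (w, x)) (Dw w x v) - Dw w x (tangentJ E₀ x v)) ≤ (ε * ‖v‖) ^ 2 :=
      (t.eventually_all.2 fun x₁ _ ↦ hKw x₁)
    filter_upwards [hall] with w hw x v v'
    obtain ⟨x₁, hx₁t, hxK⟩ := mem_iUnion₂.1 (ht (mem_univ x))
    exact hw x₁ hx₁t x hxK v v'
  /- ### Step 7: a subsequence along which all defects are `≤ 1/(m+1)` -/
  have hpoint : ∀ m : ℕ, ∃ i,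
      (proj ⁻¹' {s i} ⊆ W ∧ ∀ y ∈ W, (proj (Tr (u i, y)) = s i ↔ proj y = s₀)) ∧
      ∀ (x : M₀) (v v' : TangentSpace 𝓘(ℝ, E₀) x),
      |GT.inner (F (u i, x)) (mfderiv 𝓘(ℝ, E₀) 𝓘(ℝ, ET) (fun x ↦ F (u i, x)) x v)
          (mfderiv 𝓘(ℝ, E₀) 𝓘(ℝ, ET) (fun x ↦ F (u i, x)) x v') - ⟪v, v'⟫_ℝ| ≤
          1 / ((m : ℝ) + 1) * ‖v‖ * ‖v'‖ ∧
      GT.inner (F (u i, x))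
          (tangentJ ET (F (u i, x)) (mfderiv 𝓘(ℝ, E₀) 𝓘(ℝ, ET) (fun x ↦ F (u i, x)) x v) -
            mfderiv 𝓘(ℝ, E₀) 𝓘(ℝ, ET) (fun x ↦ F (u i, x)) x (tangentJ E₀ x v))
          (tangentJ ET (F (u i, x)) (mfderiv 𝓘(ℝ, E₀) 𝓘(ℝ, ET) (fun x ↦ F (u i, x)) x v) -
            mfderiv 𝓘(ℝ, E₀) 𝓘(ℝ, ET) (fun x ↦ F (u i, x)) x (tangentJ E₀ x v)) ≤
        (1 / ((m : ℝ) + 1) * ‖v‖) ^ 2 := fun m ↦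
    (hfibi.and (hu0.eventually (KEY (1 / ((m : ℝ) + 1)) (by positivity)))).exists
  choose ι hιfib hιbd using hpoint
  /- ### Step 8: the transported fibres `M_{ι m}` and the diffeomorphisms `Φ_m` -/
  obtain ⟨x₀⟩ := hM₀
  haveI : Nonempty M₀ := ⟨x₀⟩
  have hψ₀s : ∀ x, proj (ψ₀ x) = s₀ := fun x ↦ by
    have : ψ₀ x ∈ proj ⁻¹' {s₀} := by rw [← hψ₀r]; exact ⟨x, rfl⟩
    exact this
  have hne : ∀ m, Nonempty (Mf (ι m)) := by
    intro m
    have hy : Tr (u (ι m), ψ₀ x₀) ∈ proj ⁻¹' {s (ι m)} :=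
      ((hιfib m).2 _ (hψ₀W x₀)).2 (hψ₀s x₀)
    rw [← hψr] at hy
    obtain ⟨y, -⟩ := hy
    exact ⟨y⟩
  have hΦex : ∀ m, ∃ Φ : Diffeomorph 𝓘(ℝ, E₀) 𝓘(ℝ, Em (ι m)) M₀ (Mf (ι m)) ∞,
      ∀ x, ψ (ι m) (Φ x) = F (u (ι m), x) := by
    intro m
    haveI := hne m
    have hΘ : ContMDiffOn 𝓘(ℝ, ET) 𝓘(ℝ, ET) ∞ (fun y ↦ Tr (u (ι m), y)) W :=
      hTr.comp (contMDiffOn_const.prodMk contMDiffOn_id) fun y hy ↦ ⟨mem_univ _, hy⟩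
    have hΘ' : ContMDiffOn 𝓘(ℝ, ET) 𝓘(ℝ, ET) ∞ (fun y ↦ Sr (u (ι m), y)) W :=
      hSr.comp (contMDiffOn_const.prodMk contMDiffOn_id) fun y hy ↦ ⟨mem_univ _, hy⟩
    have hr₀ : range ψ₀ ⊆ W := by rintro _ ⟨x, rfl⟩; exact hψ₀W x
    have hr₁ : range (ψ (ι m)) ⊆ W := by rw [hψr]; exact (hιfib m).1
    have hfib' : ∀ y ∈ W, (Tr (u (ι m), y) ∈ range (ψ (ι m)) ↔ y ∈ range ψ₀) := by
      intro y hy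
      rw [hψr, hψ₀r]
      exact (hιfib m).2 y hy
    exact exists_diffeomorph_of_transport hψ₀ hψ₀i hψ₀d (hψ (ι m)) (hψi (ι m)) (hψd (ι m))
      hΘ hΘ' (fun y hy ↦ hSrW _ _ hy) (hST (u (ι m))) (hTS (u (ι m))) hr₀ hr₁ hfib'
  choose Φ hΦ using hΦex
  -- the chain rule `Dψ ∘ DΦ = D_x F(u, ·)`
  have hDΦ : ∀ m (x : M₀) (v : TangentSpace 𝓘(ℝ, E₀) x),
      mfderiv 𝓘(ℝ, Em (ι m)) 𝓘(ℝ, ET) (ψ (ι m)) (Φ m x)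
        (mfderiv 𝓘(ℝ, E₀) 𝓘(ℝ, Em (ι m)) (Φ m) x v) =
      mfderiv 𝓘(ℝ, E₀) 𝓘(ℝ, ET) (fun x ↦ F (u (ι m), x)) x v := by
    intro m x v
    have hcomp : (ψ (ι m)) ∘ (Φ m) = fun x ↦ F (u (ι m), x) := funext (hΦ m)
    have hc := mfderiv_comp x (((hψ (ι m)).mdifferentiableAt (by simp)))
      ((Φ m).mdifferentiable (by simp) x)
    rw [hcomp] at hc
    rw [hc]
    rfl
  /- ### Step 9: orientations on the fibres, transported from `M₀` -/
  have hoex := fun m ↦ exists_orientation_transport (n := n) (Φ m) o₀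
  choose o hΦo hcompat using hoex
  have hoc : ∀ m, IsContinuousOrientation (I := 𝓘(ℝ, Em (ι m))) (o m) := fun m ↦
    isContinuousOrientation_of_orientationMap (o m) o₀ ho₀c (Φ m).symm.contMDiff (hcompat m)
  have ho : ∀ m, IsSmoothForm (riemannianVolumeForm (o m)) := fun m ↦
    isSmoothForm_riemannianVolumeForm_of_isContinuousOrientation_holds (o m) (hoc m)
  /- ### Step 10: the hypotheses of the transport theorem -/
  have hΦpt : ∀ m x, ψ (ι m) (Φ m x) = F (u (ι m), x) := hΦ
  have hT : ∀ m x j l, |⟪mfderiv 𝓘(ℝ, E₀) 𝓘(ℝ, Em (ι m)) (Φ m) x (b x j),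
      mfderiv 𝓘(ℝ, E₀) 𝓘(ℝ, Em (ι m)) (Φ m) x (b x l)⟫_ℝ - (if j = l then 1 else 0)| ≤
      1 / ((m : ℝ) + 1) := by
    intro m x j l
    have horth : (if j = l then (1 : ℝ) else 0) = ⟪b x j, b x l⟫_ℝ :=
      ((orthonormal_iff_ite.1 (b x).orthonormal) j l).symm
    have hinner : ⟪mfderiv 𝓘(ℝ, E₀) 𝓘(ℝ, Em (ι m)) (Φ m) x (b x j),
        mfderiv 𝓘(ℝ, E₀) 𝓘(ℝ, Em (ι m)) (Φ m) x (b x l)⟫_ℝ =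
        GT.inner (F (u (ι m), x))
          (mfderiv 𝓘(ℝ, E₀) 𝓘(ℝ, ET) (fun x ↦ F (u (ι m), x)) x (b x j))
          (mfderiv 𝓘(ℝ, E₀) 𝓘(ℝ, ET) (fun x ↦ F (u (ι m), x)) x (b x l)) := by
      change (gM (ι m)).inner (Φ m x) _ _ = _
      rw [hgMi, metric_inner_congr_point GT (hΦpt m x), hDΦ, hDΦ]
    rw [horth, hinner]
    have key := (hιbd m x (b x j) (b x l)).1
    rwa [(b x).orthonormal.1 j, (b x).orthonormal.1 l, mul_one, mul_one] at key
  have hJ : ∀ m x, ‖(tangentJ (Em (ι m)) (Φ m x)).comp (mfderiv 𝓘(ℝ, E₀) 𝓘(ℝ, Em (ι m)) (Φ m) x) -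
      (mfderiv 𝓘(ℝ, E₀) 𝓘(ℝ, Em (ι m)) (Φ m) x).comp (tangentJ E₀ x)‖ ≤ 1 / ((m : ℝ) + 1) := by
    intro m x
    refine ContinuousLinearMap.opNorm_le_bound _ (by positivity) fun v ↦ ?_
    set a := ((tangentJ (Em (ι m)) (Φ m x)).comp (mfderiv 𝓘(ℝ, E₀) 𝓘(ℝ, Em (ι m)) (Φ m) x) -
      (mfderiv 𝓘(ℝ, E₀) 𝓘(ℝ, Em (ι m)) (Φ m) x).comp (tangentJ E₀ x)) v with ha
    have hDψa : mfderiv 𝓘(ℝ, Em (ι m)) 𝓘(ℝ, ET) (ψ (ι m)) (Φ m x) a =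
        tangentJ ET (F (u (ι m), x))
            (mfderiv 𝓘(ℝ, E₀) 𝓘(ℝ, ET) (fun x ↦ F (u (ι m), x)) x v) -
          mfderiv 𝓘(ℝ, E₀) 𝓘(ℝ, ET) (fun x ↦ F (u (ι m), x)) x (tangentJ E₀ x v) := by
      rw [ha]
      change mfderiv 𝓘(ℝ, Em (ι m)) 𝓘(ℝ, ET) (ψ (ι m)) (Φ m x)
        (tangentJ (Em (ι m)) (Φ m x) (mfderiv 𝓘(ℝ, E₀) 𝓘(ℝ, Em (ι m)) (Φ m) x v) -
          mfderiv 𝓘(ℝ, E₀) 𝓘(ℝ, Em (ι m)) (Φ m) x (tangentJ E₀ x v)) = _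
      rw [map_sub, hψJ, hDΦ, hDΦ]
      rfl
    have hsq : ‖a‖ ^ 2 ≤ (1 / ((m : ℝ) + 1) * ‖v‖) ^ 2 := by
      have key := (hιbd m x v v).2
      calc ‖a‖ ^ 2 = ⟪a, a⟫_ℝ := (real_inner_self_eq_norm_sq a).symm
        _ = (gM (ι m)).inner (Φ m x) a a := rfl
        _ = GT.inner (F (u (ι m), x)) (mfderiv 𝓘(ℝ, Em (ι m)) 𝓘(ℝ, ET) (ψ (ι m)) (Φ m x) a)
              (mfderiv 𝓘(ℝ, Em (ι m)) 𝓘(ℝ, ET) (ψ (ι m)) (Φ m x) a) := by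
            rw [hgMi, metric_inner_congr_point GT (hΦpt m x)]
        _ ≤ (1 / ((m : ℝ) + 1) * ‖v‖) ^ 2 := by rw [hDψa]; exact key
    exact (pow_le_pow_iff_left₀ (norm_nonneg _) (by positivity) two_ne_zero).1 hsq
  /- ### Step 11: conclusion by the transport theorem -/
  have happ := le_finrank_hodgePQ_of_transport g₀ o₀ hg₀K (Nat.add_sub_cancel' hk) p q
    (fun m ↦ Em (ι m)) (fun m ↦ Mf (ι m)) (fun m ↦ gM (ι m)) (fun m ↦ hgMK (ι m)) o Φ
    (fun m ↦ 1 / ((m : ℝ) + 1)) (fun m ↦ 1 / ((m : ℝ) + 1)) (fun m ↦ by positivity)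
    (fun m ↦ by positivity) tendsto_one_div_add_atTop_nhds_zero_nat
    tendsto_one_div_add_atTop_nhds_zero_nat (N := N)
  exact happ ho₀ ho b hb hΦo hT hJ fun m ↦ hN (ι m)

end Literature.AlgebraicGeometry.Motives
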